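import Summits.PneNP.PneNP.Theses.KarlinRubin
import Summits.PneNP.PneNP.Theorems.PlantedCliqueErdosRenyiNoLargeClique

/-!
# Route KarlinRubin — `ErdosRenyiNoLargeClique` (stmt-PneNP-18028)

First-moment bound for the clique number of `G(n,1/2)`: if `k(n) ≥ (2+η) log₂ n` eventually for some
`η > 0` then `Pr[G(n,1/2) has a k(n)-clique] → 0`.  The route decl
`Summit.PneNP.PneNP.Theses.KarlinRubin.ErdosRenyiNoLargeClique` is verbatim the decl
`Summit.PneNP.PneNP.Theses.PlantedClique.ErdosRenyiNoLargeClique` of route PlantedClique, proved in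
`Theorems/PlantedCliqueErdosRenyiNoLargeClique.lean` (stmt-PneNP-8686); the two `def`s unfold to the same
term, so the proof is that theorem.
[cite: AlonKrivelevichSudakov1998, §1] [cite: BarakHopkinsKelnerKothariMoitraPotechin2019, §1 Rem. 1.2]
-/

set_option linter.dupNamespace false -- `Summit.PneNP.PneNP.…`: summit = sub-problem name (D-0017 single-conjunct layout)

namespace Summit.PneNP.PneNP.Theorems

/-- **`G(n,1/2)` has no `(2+η) log₂ n`-clique w.h.p.** (route KarlinRubin, item stmt-PneNP-18028):
for every `k : ℕ → ℕ` with `(2+η) log₂ n ≤ k n` eventually (`η > 0`),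
`Pr[G(n,1/2) contains a k(n)-clique] → 0`.  Verbatim twin of the proved PlantedClique item
stmt-PneNP-8686; the proof is `plantedClique_erdosRenyiNoLargeClique_proof` transported along the
definitional unfolding of both route decls.
[cite: AlonKrivelevichSudakov1998, §1] [cite: BarakHopkinsKelnerKothariMoitraPotechin2019, §1 Rem. 1.2] -/
theorem karlinRubin_erdosRenyiNoLargeClique_proof :
    Summit.PneNP.PneNP.Theses.KarlinRubin.ErdosRenyiNoLargeClique := by
  unfold Summit.PneNP.PneNP.Theses.KarlinRubin.ErdosRenyiNoLargeClique
  exact plantedClique_erdosRenyiNoLargeClique_proof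

end Summit.PneNP.PneNP.Theorems
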